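import Mathlib
import Literature.Analysis.Asymptotics.KaramataTauberianLaplaceTwo
import HarnessLib

/-!
# `stub_karamataRieszTwo` of line `loomis-compact-horizon-witness`
(crux `EmbeddedDrudeMourre.AbelThermodynamicLimit`, item stmt-AtomisticToContinuum-12596;
`--supports` file proving the registered stub S1 verbatim, closes nothing)

The registered stub (pure real analysis): for `C : ℝ → ℝ` measurable with `|C| ≤ M` whose doubly
integrated form `V(t) = ∫₀ᵗ (t-u) C(u) du` is non-negative for `t ≥ 0`, the Abel limit
`∫₀^∞ e^{-νt} C(t) dt → L` (`ν ↓ 0`) implies the order-2 Riesz mean limit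
`∫₀^τ (1 - t/τ)² C(t) dt → L` (`τ → ∞`).

Proof.
* Fubini on the triangle `0 < u ≤ t` (`fubini_triangle`, absolute integrability from `|C| ≤ M`):
  for a kernel `φ` with `∫₀^∞ |φ(t)| t² dt < ∞`,
  `∫₀^∞ φ(t) V(t) dt = ∫₀^∞ C(u) (∫_{t ≥ u} φ(t)(t-u) dt) du`.
* `φ(t) = e^{-νt}`: `∫_{t ≥ u} e^{-νt}(t-u) dt = e^{-νu}/ν²`, so `ν² ∫₀^∞ e^{-νt} V(t) dt =
  ∫₀^∞ e^{-νt} C(t) dt → L` (`laplace_doubleIntegral`).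
* Karamata's Tauberian theorem at index `2` for the non-negative density `V`
  (`Literature.Analysis.Asymptotics.karamata_tauberian_laplace_two`, Feller II XIII.5 Thm 2):
  `τ⁻² ∫₀^τ V → L/2`.
* `φ = 𝟙_{(0,τ]}`: `∫₀^τ V = ½ ∫₀^τ (τ-u)² C(u) du` (`riesz_doubleIntegral`), i.e.
  `∫₀^τ (1 - t/τ)² C(t) dt = 2 τ⁻² ∫₀^τ V → L`.
-/

noncomputable section

open MeasureTheory Filter Set
open Literature.Analysis.Asymptotics
open scoped Topology

namespace Summit.AtomisticToContinuum.FouriersLaw.Theorems.AbelThermodynamicLimit.LoomisCompactHorizonWitness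

variable {C : ℝ → ℝ} {M : ℝ}

/-- **Fubini on the triangle `0 < u ≤ t`.** For `C` measurable with `|C| ≤ M` and a measurable
kernel `φ` with `∫₀^∞ |φ(t)| t² dt < ∞`: `t ↦ φ(t) V(t)` is integrable on `(0,∞)`, where
`V(t) = ∫₀ᵗ (t-u) C(u) du`, and `∫₀^∞ φ(t) V(t) dt = ∫₀^∞ C(u) (∫_{t ≥ u} φ(t)(t-u) dt) du`.
[folklore] -/
theorem fubini_triangle (hC : Measurable C) (hM : ∀ t, |C t| ≤ M) {φ : ℝ → ℝ}
    (hφ : Measurable φ) (hφi : IntegrableOn (fun t => φ t * t ^ 2) (Ioi 0)) :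
    IntegrableOn (fun t => φ t * ∫ u in Ioc 0 t, (t - u) * C u) (Ioi 0) ∧
      ∫ t in Ioi (0 : ℝ), φ t * ∫ u in Ioc 0 t, (t - u) * C u =
        ∫ u in Ioi (0 : ℝ), C u * ∫ t in Ici u, φ t * (t - u) := by
  set f : ℝ → ℝ → ℝ := fun t u => if u ≤ t then φ t * (t - u) * C u else 0 with hf
  have hFm : Measurable (Function.uncurry f) := by
    refine Measurable.ite (measurableSet_le measurable_snd measurable_fst) ?_ measurable_const
    exact ((hφ.comp measurable_fst).mul (measurable_fst.sub measurable_snd)).mul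
      (hC.comp measurable_snd)
  -- sections in `u` for fixed `t`
  have h1 : ∀ t, ∫ u in Ioi 0, f t u = φ t * ∫ u in Ioc 0 t, (t - u) * C u := by
    intro t
    have : f t = (Iic t).indicator (fun u => φ t * ((t - u) * C u)) := by
      funext u
      simp only [hf, Set.indicator_apply, Set.mem_Iic]
      split_ifs <;> ring
    rw [this, setIntegral_indicator measurableSet_Iic, Ioi_inter_Iic, integral_const_mul]
  -- sections in `t` for fixed `u > 0`
  have h2 : ∀ u, 0 < u → ∫ t in Ioi 0, f t u = C u * ∫ t in Ici u, φ t * (t - u) := by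
    intro u hu
    have : (fun t => f t u) = (Ici u).indicator (fun t => C u * (φ t * (t - u))) := by
      funext t
      simp only [hf, Set.indicator_apply, Set.mem_Ici]
      split_ifs <;> ring
    have hset : Ioi (0 : ℝ) ∩ Ici u = Ici u :=
      Set.inter_eq_right.mpr fun t ht => lt_of_lt_of_le hu ht
    rw [this, setIntegral_indicator measurableSet_Ici, hset, integral_const_mul]
  -- each `u`-section is bounded by `|φ t| |t| M` and vanishes off `(0, t]`
  have hbd : ∀ t, ∀ u ∈ Ioc (0 : ℝ) t, ‖f t u‖ ≤ |φ t| * |t| * M := by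
    intro t u hu
    simp only [hf, if_pos hu.2, Real.norm_eq_abs, abs_mul]
    have hut : |t - u| ≤ |t| := by
      rw [abs_of_nonneg (by linarith [hu.2]), abs_of_pos (lt_of_lt_of_le hu.1 hu.2)]
      linarith [hu.1]
    have hM0 : 0 ≤ M := (abs_nonneg _).trans (hM 0)
    have hCu : |C u| ≤ M := hM u
    gcongr
  have hzero : ∀ t, ∀ u ∈ Ioi (0 : ℝ) \ Ioc 0 t, f t u = 0 := by
    intro t u hu
    have : ¬ u ≤ t := fun h => hu.2 ⟨hu.1, h⟩
    simp only [hf, if_neg this]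
  have hsec : ∀ t, IntegrableOn (f t) (Ioi 0) := by
    intro t
    have hIoc : IntegrableOn (f t) (Ioc 0 t) :=
      Measure.integrableOn_of_bounded (M := |φ t| * |t| * M) measure_Ioc_lt_top.ne
        hFm.of_uncurry_left.aestronglyMeasurable
        ((ae_restrict_iff' measurableSet_Ioc).mpr (ae_of_all _ (hbd t)))
    exact hIoc.of_forall_sdiff_eq_zero measurableSet_Ioi (hzero t)
  -- the norm integrals of the sections are dominated by `M |φ t| t²`
  have hnorm : ∀ t ∈ Ioi (0 : ℝ), ∫ u in Ioi 0, ‖f t u‖ ≤ M * ‖φ t * t ^ 2‖ := by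
    intro t ht
    have ht0 : 0 < t := ht
    rw [setIntegral_eq_of_subset_of_forall_sdiff_eq_zero measurableSet_Ioi Ioc_subset_Ioi_self
      (fun u hu => by rw [hzero t u hu, norm_zero])]
    have h := norm_setIntegral_le_of_norm_le_const (μ := volume) (s := Ioc 0 t)
      (f := fun u => ‖f t u‖) (C := |φ t| * |t| * M) measure_Ioc_lt_top
      (fun u hu => by rw [norm_norm]; exact hbd t u hu)
    rw [Real.volume_real_Ioc_of_le ht0.le, sub_zero] at h
    calc ∫ u in Ioc 0 t, ‖f t u‖ ≤ ‖∫ u in Ioc 0 t, ‖f t u‖‖ := Real.le_norm_self _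
      _ ≤ |φ t| * |t| * M * t := h
      _ = M * ‖φ t * t ^ 2‖ := by
          rw [Real.norm_eq_abs, abs_mul, abs_of_nonneg (sq_nonneg t), abs_of_pos ht0]; ring
  -- integrability on the product `(0,∞) × (0,∞)`
  have hint : Integrable (Function.uncurry f)
      ((volume.restrict (Ioi (0 : ℝ))).prod (volume.restrict (Ioi (0 : ℝ)))) := by
    rw [integrable_prod_iff hFm.aestronglyMeasurable]
    refine ⟨ae_of_all _ fun t => hsec t, ?_⟩
    refine Integrable.mono' (g := fun t => M * ‖φ t * t ^ 2‖) (hφi.norm.const_mul M)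
      hFm.aestronglyMeasurable.norm.integral_prod_right' ?_
    rw [ae_restrict_iff' measurableSet_Ioi]
    refine ae_of_all _ fun t ht => ?_
    rw [Real.norm_eq_abs, abs_of_nonneg (integral_nonneg fun _ => norm_nonneg _)]
    exact hnorm t ht
  refine ⟨?_, ?_⟩
  · have h := hint.integral_prod_left
    refine h.congr (ae_of_all _ fun t => ?_)
    exact h1 t
  · calc ∫ t in Ioi (0 : ℝ), φ t * ∫ u in Ioc 0 t, (t - u) * C u
        = ∫ t in Ioi (0 : ℝ), ∫ u in Ioi (0 : ℝ), f t u :=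
          integral_congr_ae (ae_of_all _ fun t => (h1 t).symm)
      _ = ∫ u in Ioi (0 : ℝ), ∫ t in Ioi (0 : ℝ), f t u := integral_integral_swap hint
      _ = ∫ u in Ioi (0 : ℝ), C u * ∫ t in Ici u, φ t * (t - u) :=
          setIntegral_congr_fun measurableSet_Ioi fun u hu => h2 u hu

/-- Translation of a half-line integral: `∫_{t ≥ u} g(t) dt = ∫_{r ≥ 0} g(r + u) dr`.
[folklore] -/
theorem setIntegral_Ici_eq_add (g : ℝ → ℝ) (u : ℝ) :
    ∫ t in Ici u, g t = ∫ r in Ici (0 : ℝ), g (r + u) := by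
  rw [← integral_indicator measurableSet_Ici, ← integral_indicator measurableSet_Ici,
    ← integral_add_right_eq_self (fun t => (Ici u).indicator g t) u]
  congr 1
  funext r
  simp only [Set.indicator_apply, Set.mem_Ici]
  by_cases h : 0 ≤ r
  · rw [if_pos (by linarith), if_pos h]
  · rw [if_neg (by intro h'; exact h (by linarith)), if_neg h]

/-- `∫_{t ≥ u} e^{-νt} (t-u) dt = e^{-νu}/ν²` for `ν > 0` (`Γ(2) = 1`). [folklore] -/
theorem integral_Ici_exp_neg_mul_sub {ν : ℝ} (hν : 0 < ν) (u : ℝ) :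
    ∫ t in Ici u, Real.exp (-(ν * t)) * (t - u) = Real.exp (-(ν * u)) / ν ^ 2 := by
  rw [setIntegral_Ici_eq_add]
  have : (fun r => Real.exp (-(ν * (r + u))) * (r + u - u)) =
      fun r => Real.exp (-(ν * u)) * (r * Real.exp (-(ν * r))) := by
    funext r
    rw [show -(ν * (r + u)) = -(ν * u) + -(ν * r) by ring, Real.exp_add]
    ring
  rw [this, integral_const_mul, integral_Ici_eq_integral_Ioi]
  have h := KaramataLaplace.laplace_id hν
  unfold KaramataLaplace.laplace at h
  rw [h]
  ring

/-- **Laplace transform of the doubly integrated form.** For `ν > 0`: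
`t ↦ e^{-νt} V(t)` is integrable on `(0,∞)` and `ν² ∫₀^∞ e^{-νt} V(t) dt = ∫₀^∞ e^{-νt} C(t) dt`,
`V(t) = ∫₀ᵗ (t-u) C(u) du`. [folklore] -/
theorem laplace_doubleIntegral (hC : Measurable C) (hM : ∀ t, |C t| ≤ M) {ν : ℝ} (hν : 0 < ν) :
    IntegrableOn (fun t => Real.exp (-(ν * t)) * ∫ u in Ioc 0 t, (t - u) * C u) (Ioi 0) ∧
      ν ^ 2 * ∫ t in Ioi (0 : ℝ), Real.exp (-(ν * t)) * ∫ u in Ioc 0 t, (t - u) * C u =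
        ∫ t in Ioi (0 : ℝ), Real.exp (-(ν * t)) * C t := by
  have hφ : Measurable fun t : ℝ => Real.exp (-(ν * t)) := by fun_prop
  have hφi : IntegrableOn (fun t : ℝ => Real.exp (-(ν * t)) * t ^ 2) (Ioi 0) := by
    have h := integrableOn_rpow_mul_exp_neg_mul_rpow (s := 2) (p := 1) (by norm_num) le_rfl hν
    refine h.congr_fun (fun t _ => ?_) measurableSet_Ioi
    simp only [Real.rpow_two, Real.rpow_one, neg_mul]
    ring
  obtain ⟨hi, heq⟩ := fubini_triangle hC hM hφ hφi
  refine ⟨hi, ?_⟩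
  rw [heq]
  have : ∀ u, C u * ∫ t in Ici u, Real.exp (-(ν * t)) * (t - u) =
      (ν ^ 2)⁻¹ * (Real.exp (-(ν * u)) * C u) := by
    intro u
    rw [integral_Ici_exp_neg_mul_sub hν]
    ring
  simp_rw [this]
  rw [integral_const_mul, ← mul_assoc, mul_inv_cancel₀ (by positivity), one_mul]

/-- **The order-2 Riesz identity.** For every `τ` (both sides vanish for `τ ≤ 0`):
`∫₀^τ V(t) dt = ∫₀^τ (τ-u)²/2 · C(u) du`, `V(t) = ∫₀ᵗ (t-u) C(u) du`. [folklore] -/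
theorem riesz_doubleIntegral (hC : Measurable C) (hM : ∀ t, |C t| ≤ M) (τ : ℝ) :
    ∫ t in Ioc (0 : ℝ) τ, (∫ u in Ioc 0 t, (t - u) * C u) =
      ∫ u in Ioc (0 : ℝ) τ, (τ - u) ^ 2 / 2 * C u := by
  set φ : ℝ → ℝ := fun t => if t ≤ τ then 1 else 0 with hφdef
  have hφ : Measurable φ := Measurable.ite measurableSet_Iic measurable_const measurable_const
  have hφi : IntegrableOn (fun t => φ t * t ^ 2) (Ioi 0) := by
    have : (fun t => φ t * t ^ 2) = (Iic τ).indicator fun t => t ^ 2 := by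
      funext t; simp only [hφdef, Set.indicator_apply, Set.mem_Iic]; split_ifs <;> simp
    rw [this, IntegrableOn, integrable_indicator_iff measurableSet_Iic, IntegrableOn,
      Measure.restrict_restrict measurableSet_Iic, Iic_inter_Ioi]
    exact ((continuous_pow 2).integrableOn_Icc (a := 0) (b := τ)).mono_set Ioc_subset_Icc_self
  obtain ⟨-, heq⟩ := fubini_triangle hC hM hφ hφi
  -- left-hand side
  have hl : ∫ t in Ioi (0 : ℝ), φ t * ∫ u in Ioc 0 t, (t - u) * C u =
      ∫ t in Ioc (0 : ℝ) τ, ∫ u in Ioc 0 t, (t - u) * C u := by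
    have : (fun t => φ t * ∫ u in Ioc 0 t, (t - u) * C u) =
        (Iic τ).indicator fun t => ∫ u in Ioc 0 t, (t - u) * C u := by
      funext t; simp only [hφdef, Set.indicator_apply, Set.mem_Iic]; split_ifs <;> simp
    rw [this, setIntegral_indicator measurableSet_Iic, Ioi_inter_Iic]
  -- inner integrals on the right-hand side
  have hin : ∀ u ∈ Ioi (0 : ℝ), C u * ∫ t in Ici u, φ t * (t - u) =
      (Iic τ).indicator (fun u => (τ - u) ^ 2 / 2 * C u) u := by
    intro u _
    by_cases huτ : u ≤ τ
    · rw [Set.indicator_of_mem (show u ∈ Iic τ from huτ)]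
      have : (fun t => φ t * (t - u)) = (Iic τ).indicator fun t => t - u := by
        funext t; simp only [hφdef, Set.indicator_apply, Set.mem_Iic]; split_ifs <;> simp
      rw [this, setIntegral_indicator measurableSet_Iic, Ici_inter_Iic,
        integral_Icc_eq_integral_Ioc, ← intervalIntegral.integral_of_le huτ,
        intervalIntegral.integral_comp_sub_right (fun x => x) u, integral_id]
      ring
    · rw [Set.indicator_of_notMem (show u ∉ Iic τ from huτ),
        setIntegral_eq_zero_of_forall_eq_zero fun t ht => ?_, mul_zero]
      have : ¬ t ≤ τ := fun h => huτ (le_trans ht h)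
      simp only [hφdef, if_neg this, zero_mul]
  rw [← hl, heq, setIntegral_congr_fun measurableSet_Ioi hin,
    setIntegral_indicator measurableSet_Iic, Ioi_inter_Iic]

/-- **S1 `stub_karamataRieszTwo` — Hardy–Littlewood–Karamata Tauberian theorem, index 2,
Riesz-window form.** For `C : ℝ → ℝ` measurable with `|C| ≤ M` whose doubly integrated form
`V(t) = ∫₀ᵗ (t-u) C(u) du` is non-negative for `t ≥ 0`, the Abel limit
`∫₀^∞ e^{-νt} C(t) dt → L` (`ν ↓ 0`) implies `∫₀^τ (1 - t/τ)² C(t) dt → L` (`τ → ∞`).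
Proof: `ν² ∫₀^∞ e^{-νt} V = ∫₀^∞ e^{-νt} C → L` (`laplace_doubleIntegral`), Karamata at index 2
(`karamata_tauberian_laplace_two`) gives `τ⁻² ∫₀^τ V → L/2`, and
`∫₀^τ (1 - t/τ)² C = 2 τ⁻² ∫₀^τ V` (`riesz_doubleIntegral`).
[cite: Feller1971, XIII.5 Theorem 2 (ρ = 2)] -/
theorem stub_karamataRieszTwo :
    ∀ (C : ℝ → ℝ) (L M : ℝ), Measurable C → (∀ t : ℝ, |C t| ≤ M) →
      (∀ t : ℝ, 0 ≤ t → 0 ≤ ∫ u in Set.Ioc (0 : ℝ) t, (t - u) * C u) →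
      Filter.Tendsto (fun ν : ℝ => ∫ t in Set.Ioi (0 : ℝ), Real.exp (-(ν * t)) * C t)
        (nhdsWithin (0 : ℝ) (Set.Ioi 0)) (nhds L) →
      Filter.Tendsto (fun τ : ℝ => ∫ t in Set.Ioc (0 : ℝ) τ, (1 - t / τ) ^ 2 * C t)
        Filter.atTop (nhds L) := by
  intro C L M hC hM hV hAbel
  set V : ℝ → ℝ := fun t => ∫ u in Ioc (0 : ℝ) t, (t - u) * C u with hVdef
  have hu : ∀ t, 0 < t → 0 ≤ V t := fun t ht => hV t ht.le
  have hint : ∀ δ : ℝ, 0 < δ → IntegrableOn (fun t => V t * Real.exp (-(δ * t))) (Ioi 0) := by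
    intro δ hδ
    refine ((laplace_doubleIntegral hC hM hδ).1).congr_fun (fun t _ => ?_) measurableSet_Ioi
    simp only [hVdef]
    ring
  have hω : Tendsto (fun δ : ℝ => δ ^ 2 * ∫ t in Ioi (0 : ℝ), V t * Real.exp (-(δ * t)))
      (𝓝[>] 0) (𝓝 L) := by
    refine hAbel.congr' ?_
    filter_upwards [self_mem_nhdsWithin] with δ hδ
    have hδ0 : 0 < δ := hδ
    rw [← (laplace_doubleIntegral hC hM hδ0).2]
    congr 1
    refine integral_congr_ae (ae_of_all _ fun t => ?_)
    simp only [hVdef]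
    ring
  have hK := karamata_tauberian_laplace_two hu hint hω
  -- `R(τ) = 2 τ⁻² ∫₀^τ V`
  have hR : ∀ᶠ τ : ℝ in atTop, 2 * ((∫ t in Ioc 0 τ, V t) / τ ^ 2) =
      ∫ t in Ioc (0 : ℝ) τ, (1 - t / τ) ^ 2 * C t := by
    filter_upwards [eventually_gt_atTop 0] with τ hτ
    have hτ0 : τ ≠ 0 := hτ.ne'
    simp only [hVdef]
    rw [riesz_doubleIntegral hC hM τ,
      show 2 * ((∫ u in Ioc (0 : ℝ) τ, (τ - u) ^ 2 / 2 * C u) / τ ^ 2) =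
        (2 / τ ^ 2) * ∫ u in Ioc (0 : ℝ) τ, (τ - u) ^ 2 / 2 * C u by ring,
      ← integral_const_mul]
    refine setIntegral_congr_fun measurableSet_Ioc (fun u _ => ?_)
    field_simp
  have h := (hK.const_mul 2).congr' hR
  rwa [show (2 : ℝ) * (L / 2) = L by ring] at h

end Summit.AtomisticToContinuum.FouriersLaw.Theorems.AbelThermodynamicLimit.LoomisCompactHorizonWitness
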